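/-
Copyright (c) 2026 the pub-hodgecm-mathlib formalisation cell (harness21).  Prover seat hodgecm-mathlib-K2Liu-p11 (g5), Track B «K2-LIT»,
#184♮ = hLiu418 = `stmt-HodgeConjecture-24832`; socket #41 `sig_K2LiuSiegelEisensteinContinuation`, KIND W, brick (x-a-hex-asm): THE TIE'S STEP-4b `hex` BLOCK
DONE ONCE — ★ p863767 ∃-frame head ∘ ★ p863806 `heb_of_skew` ∘ ★ K2E3-p11's sign dispatch `hW_of_signCases`, residue = the two analytic letters `hWhol`, `hInd` BY VALUE
(KW desk F0P2-p08 (g3) 2026-09-05T00:51:59Z (E)); box K2Liu-audit1.  THEOREMS ONLY (no `def`, no `instance`, no notation, no named-fact hypothesis, no `sorry`,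
default heartbeats).
-/
import Summits.HodgeConjecture.HodgeConjecture.Theorems.K2LiuKindWArchContinuationGuardedOfRecord  -- ★ p863767 (F0P2-p08 ∕ LH4-p10): `exists_frames_hex_of_std'` (frames of record, `hex` ⇐ heb, hW')
import Summits.HodgeConjecture.HodgeConjecture.Theorems.K2LiuKindWArchFramedIndexHermitian       -- ★ p863806 (this seat): `heb_of_skew`, `framedIndex_conjTranspose_of_frame`, `framedIndex_det_ne_zero_of_frame`
import Summits.HodgeConjecture.HodgeConjecture.Theorems.K2LiuKindWArchWhittakerLetterDispatch    -- ★ K2E3-p11 (g10): `hW_of_signCases` (the per-place letter from the sign type of the framed index)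
import HarnessLib

/-!
# Crux `HLiu418`, socket #41, KIND W — brick (x-a-hex-asm) `K2LiuKindWArchHexOfDispatch`: THE ARCHIMEDEAN CONTINUATION LETTER `hex` OF THE KIND-W COLUMN
# FROM THE FRAMES OF RECORD, THE CHARACTER'S FRAME READING AND THE SIGN DISPATCH — residue `hWhol` (holomorphy through a flat family), `hInd` (indefinite organ)

Cell `hodgecm-mathlib`, crux item hLiu418 = `stmt-HodgeConjecture-24832` (helper lane `--supports … --as helper`, count-neutral), route of record
`HCCMUnconditional`; squad K2 ∕ K2Liu, road `K2_Liu`, socket #41, KIND W; KW desk of record F0P2-p08 (g3).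
THE POINT.  The KIND-W `hex` letter of ★ `K2LiuKindWArchLetterDefs.kindWArchLetter_eq_integral` (the continuation to `{0 < re}` of the twisted archimedean block of
each (KW-fac) arch factor, per non-singular skew index `S` and `h`) is, by ★ p863767 `K2LiuKindWArchContinuationGuardedOfRecord.exists_frames_hex_of_std'`, a consequence of
TWO by-value letters spoken about the tube frames of record `(T, T⁻¹, Fr, B, C, g)`: the character's frame reading `heb` and the guarded per-place twisted Whittaker
letter `hW'`.  ★ p863806 `K2LiuKindWArchFramedIndexHermitian.heb_of_skew` PAYS `heb` (no letter); ★ `K2LiuKindWArchWhittakerLetterDispatch.hW_of_signCases` (K2E3-p11) PAYS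
`hW'` from the SIGN TYPE of the framed index `h_w(S) = −2·(T_w)₂₂·σ_w(S)·(T_w⁻¹)₁₁` (hermitian ★ `framedIndex_conjTranspose_of_frame`, non-singular under the guard ★
`framedIndex_det_ne_zero_of_frame`; definite ★ p863390 ∕ negative-definite ★ `…NegDef` by name) modulo the holomorphy-through-a-flat-family letter `hWhol` and the
indefinite organ `hInd` («Φ6b-ind»).  THIS FILE does the composition ONCE, so the tie's Step-4b `hex` slot is ONE name with residue {`hWhol`, `hInd`}:
* **`hex_of_dispatch`** — inputs: ★ p863767's (`hdV0 hdW0 ht 𝒦' h𝒦' s₀ A hAlaw hfin hAc FinfT hread T₀ νinf`), the weight window `hk : −2 ≤ −t_w` ((G4); ★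
  `K2LiuKindWArchTypeOfRecord` pays it for the `lam` of record), and BY VALUE `hWhol` — ∀-CLOSED OVER THE DISPATCH'S ABSTRACT DATA `(B C Pt hidx eb)` with exactly the four
  facts an analytic payer can use (`antidiag(B,C) ∈ U(J)`, `Pt ∈ U(J)`, `hidx` hermitian, `eb = e(−tr(hidx ·))`; frame-free) — and `hInd` (the dispatch's telescope
  VERBATIM, frame-free) ⊢ ★ p863767's conclusion VERBATIM (= ★ p863152's `hex` under the guard `det ↑S ≠ 0`).
  Proof: `obtain` the frames of record; `hx` (antidiagonal ∈ U(J)) = ★ `frame_archPart_weylDelta` + `hBC` + ★ `frame_mem`; `hPt` = ★ `frame_mem` at `h_∞·g`; `hherm`∕`hdet` = ★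
  p863806; `heb` = ★ `heb_of_skew` (`eb := e(−tr(h_w(↑S)·b))`, `hebr := rfl`); `hW' := hW_of_signCases …`.
[Shimura1982, §3 Thm. 3.1, §4 Thm. 4.2] [Shimura1997, §16.4, §18.4] [KudlaRallis1994, §1–§2] [MoeglinWaldspurger1995, II.1.5, IV.1.9] [BorelJacquet1979, §4.1].
HONEST LABEL.  Count-neutral helper; closes no socket by itself: `HC_CM` is proved only modulo the 7 printed citations (2 remaining named inputs:
hLiu418 = `stmt-HodgeConjecture-24832`, h413 = `stmt-HodgeConjecture-24833`) until rung 0 closes.  NOT HERE (by value): `hWhol` (holomorphy of the twisted integral through a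
flat family on `{1 < re s}` — LH4-p10 (g9) `hWhol_of_std`, LEAD #200) and `hInd` (the indefinite-index arch organ «Φ6b-ind», K2E4-p11).

## References
* [Shimura1982] G. Shimura, *Confluent hypergeometric functions on tube domains*, Math. Ann. 260 (1982), §3 Thm. 3.1, §4 Thm. 4.2.
* [Shimura1997] G. Shimura, *Euler Products and Eisenstein Series*, CBMS 93 (1997), §16.4, §18.4.
* [KudlaRallis1994] S. Kudla, S. Rallis, Ann. of Math. 140 (1994), §1–§2.
* [MoeglinWaldspurger1995] C. Mœglin, J.-L. Waldspurger, *Spectral Decomposition and Eisenstein Series* (1995), II.1.5, IV.1.9.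
* [BorelJacquet1979] A. Borel, H. Jacquet, Proc. Symp. Pure Math. 33 (1979), §4.1.
-/

set_option autoImplicit false
set_option linter.dupNamespace false -- the mandated namespace repeats `HodgeConjecture.HodgeConjecture`

noncomputable section

open scoped Matrix ComplexConjugate Classical
open Complex Matrix MeasureTheory MeasureTheory.Measure NumberField NumberField.InfinitePlace IsDedekindDomain
open Literature.NumberTheory.ModularForms.SiegelUpperHalfSpace (moeb)
open Literature.NumberTheory.Automorphic Literature.NumberTheory.Automorphic.UnitaryGroup Literature.NumberTheory.GaloisRepresentations
open Literature.NumberTheory.GelbartRogawski1991 Literature.NumberTheory.GelbartRogawski1991.GRConstruction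
open Literature.NumberTheory.GelbartRogawski1991.UnitaryDualPair
open Literature.NumberTheory.K2Lit.SiegelDoubled

namespace Summit.HodgeConjecture.HodgeConjecture.Cruxes.HLiu418.K2LiuKindWArchHexOfDispatch

open K2LiuU22CompactPictureDefs K2LiuArchInducedTubeDefs K2LiuSiegelUnipotentLocalDefs K2LiuArchSWSpanningDefs
open K2LiuSiegelUnipotentFourierDefs (skewMatrices unipDeltaChar)
open K2LiuSiegelEisensteinKindWLetters (kindWFinset)
open K2LiuKindWArchLetterDefs (archWhittakerIntegral)
open K2LiuHolTubeRigidityOfFrame (frame_mem frame_archPart_weylDelta)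
open K2LiuKindWArchContinuationGuardedOfRecord (exists_frames_hex_of_std')
open K2LiuKindWArchFramedIndexHermitian (heb_of_skew framedIndex_conjTranspose_of_frame framedIndex_det_ne_zero_of_frame)
open K2LiuKindWArchWhittakerLetterDispatch (hW_of_signCases)

variable (L : Type) [Field L] [NumberField L] [IsCMField L]
variable {N₀ M₀ : ℕ} (e : Fin N₀ × Fin M₀ ≃ Fin 2)
  (dV : Fin N₀ → L) (hdV : ∀ i, IsCMField.complexConj L (dV i) = dV i)
  (dW : Fin M₀ → L) (hdW : ∀ i, IsCMField.complexConj L (dW i) = dW i)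
  [MeasurableSpace ↥(unipDeltaArch L e dV hdV dW hdW)] [BorelSpace ↥(unipDeltaArch L e dV hdV dW hdW)]

/-- **THE KIND-W ARCHIMEDEAN `hex` LETTER FROM THE DISPATCH** (see the module docstring): ★ p863767's inputs + the weight window `hk` + the two analytic letters `hWhol`
(∀-closed over the dispatch's abstract data, frame-free) and `hInd` (frame-free) ⊢ ★ p863767's conclusion VERBATIM — for every term `j`, every non-singular skew index `S`
and every `h`, the archimedean Whittaker integral of `FinfT j S h` at `h_∞` continues holomorphically to `{0 < re s}` from `{2∕2 < re s}`.
[cite: Shimura1982, §3 Thm. 3.1, §4 Thm. 4.2] [cite: Shimura1997, §16.4, §18.4] [cite: KudlaRallis1994, §1–§2] [cite: MoeglinWaldspurger1995, II.1.5, IV.1.9] -/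
theorem hex_of_dispatch (hdV0 : ∀ i, dV i ≠ 0) (hdW0 : ∀ i, dW i ≠ 0)
    {χ : HeckeCharacter L} {t : InfinitePlace L → ℤ} (ht : χ.HasUnitaryArchType t 0)
    (hk : ∀ w : {w : InfinitePlace L // w.IsComplex}, (-2 : ℤ) ≤ -(t w.1))
    (𝒦' : IwasawaDatum L e dV hdV dW hdW) (h𝒦' : 𝒦'.IsStd) (s₀ : ℂ) {m : ℕ}
    (A : Fin m → UnitaryGroup.arch (Fp L) L (IsCMField.complexConj L) (2 + 2) (hermD L e dV hdV dW hdW) → ℂ)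
    (hAlaw : ∀ j, ∀ p : HA L e dV hdV dW hdW, IsSiegelDelta L e dV hdV dW hdW p → UnitaryGroup.finPart (Fp L) L (IsCMField.complexConj L) (2 + 2) (hermD L e dV hdV dW hdW) p = 1 →
      ∀ x : UnitaryGroup.arch (Fp L) L (IsCMField.complexConj L) (2 + 2) (hermD L e dV hdV dW hdW),
        A j (UnitaryGroup.archPart (Fp L) L (IsCMField.complexConj L) (2 + 2) (hermD L e dV hdV dW hdW) p * x) = siegelDeltaCharacter L e dV hdV dW hdW χ s₀ p * A j x)
    (hfin : ∀ j, ∃ V : Submodule ℂ (UnitaryGroup.arch (Fp L) L (IsCMField.complexConj L) (2 + 2) (hermD L e dV hdV dW hdW) → ℂ), FiniteDimensional ℂ V ∧ A j ∈ V ∧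
      ∀ a₀ : UnitaryGroup.arch (Fp L) L (IsCMField.complexConj L) (2 + 2) (hermD L e dV hdV dW hdW),
        (UnitaryGroup.archToAdelic (Fp L) L (IsCMField.complexConj L) (2 + 2) (hermD L e dV hdV dW hdW) a₀ : HA L e dV hdV dW hdW) ∈ 𝒦'.K → ∀ G ∈ V, (fun x => G (x * a₀)) ∈ V)
    (hAc : ∀ j, Continuous (A j))
    (FinfT : Fin m → skewMatrices ((IsCMField.complexConj L : L ≃ₐ[Fp L] L) : L →+* L) ((gramR L e dV hdV dW hdW).map (algebraMap (Fp L) L)) →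
      HA L e dV hdV dW hdW → ℂ → UnitaryGroup.arch (Fp L) L (IsCMField.complexConj L) (2 + 2) (hermD L e dV hdV dW hdW) → ℂ)
    (hread : ∀ (S : skewMatrices ((IsCMField.complexConj L : L ≃ₐ[Fp L] L) : L →+* L) ((gramR L e dV hdV dW hdW).map (algebraMap (Fp L) L))) (h : HA L e dV hdV dW hdW)
      (s : ℂ) (j : Fin m) (a : UnitaryGroup.arch (Fp L) L (IsCMField.complexConj L) (2 + 2) (hermD L e dV hdV dW hdW)),
      FinfT j S h s a =
        (((modDelta L e dV hdV dW hdW (𝒦'.pPart (UnitaryGroup.archToAdelic (Fp L) L (IsCMField.complexConj L) (2 + 2) (hermD L e dV hdV dW hdW) a)) : ℝ) : ℂ) ^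
            (2 * (s - s₀))) * A j a)
    (T₀ : Finset (HeightOneSpectrum (𝓞 (Fp L))))
    (νinf : Finset (HeightOneSpectrum (𝓞 (Fp L))) → Measure ↥(unipDeltaArch L e dV hdV dW hdW)) [∀ T' : Finset (HeightOneSpectrum (𝓞 (Fp L))), (νinf T').IsHaarMeasure]
    (hWhol : ∀ (B C : {w : InfinitePlace L // w.IsComplex} → Matrix (Fin 2) (Fin 2) ℂ)
      (Pt : skewMatrices ((IsCMField.complexConj L : L ≃ₐ[Fp L] L) : L →+* L) ((gramR L e dV hdV dW hdW).map (algebraMap (Fp L) L)) → HA L e dV hdV dW hdW → {w : InfinitePlace L // w.IsComplex} → Matrix (Fin 2 ⊕ Fin 2) (Fin 2 ⊕ Fin 2) ℂ)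
      (hidx : skewMatrices ((IsCMField.complexConj L : L ≃ₐ[Fp L] L) : L →+* L) ((gramR L e dV hdV dW hdW).map (algebraMap (Fp L) L)) → HA L e dV hdV dW hdW → {w : InfinitePlace L // w.IsComplex} → Matrix (Fin 2) (Fin 2) ℂ)
      (eb : skewMatrices ((IsCMField.complexConj L : L ≃ₐ[Fp L] L) : L →+* L) ((gramR L e dV hdV dW hdW).map (algebraMap (Fp L) L)) → HA L e dV hdV dW hdW → {w : InfinitePlace L // w.IsComplex} → Matrix (Fin 2) (Fin 2) ℂ → ℂ),
      (∀ w, (fromBlocks 0 (B w) (C w) 0 : Matrix (Fin 2 ⊕ Fin 2) (Fin 2 ⊕ Fin 2) ℂ)ᴴ * Matrix.J (Fin 2) ℂ *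
        (fromBlocks 0 (B w) (C w) 0 : Matrix (Fin 2 ⊕ Fin 2) (Fin 2 ⊕ Fin 2) ℂ) = Matrix.J (Fin 2) ℂ) →
      (∀ S h w, (Pt S h w)ᴴ * Matrix.J (Fin 2) ℂ * Pt S h w = Matrix.J (Fin 2) ℂ) →
      (∀ S h w, (hidx S h w)ᴴ = hidx S h w) →
      (∀ S h w (b : Matrix (Fin 2) (Fin 2) ℂ), eb S h w b = cexp (-(2 * Real.pi * I) * (hidx S h w * b).trace)) →
      ∀ (S : skewMatrices ((IsCMField.complexConj L : L ≃ₐ[Fp L] L) : L →+* L) ((gramR L e dV hdV dW hdW).map (algebraMap (Fp L) L))),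
      (S : Matrix (Fin 2) (Fin 2) L).det ≠ 0 → ∀ (h : HA L e dV hdV dW hdW) (w : {w : InfinitePlace L // w.IsComplex}) (Q : Carrier), ∀ s' : ℂ, ((2 : ℕ) : ℝ) / 2 < s'.re → ∀ F₀ : Matrix (Fin 2 ⊕ Fin 2) (Fin 2 ⊕ Fin 2) ℂ → ℂ,
      IsArchSiegelSection (fun z : ℂ => (conj z / ((‖z‖ : ℝ) : ℂ)) ^ (-(t w.1))) s' F₀ →
      (∀ (v : Matrix (Fin 2) (Fin 2) ℂ), vᴴ * v = 1 → ∀ hv : v.det ≠ 0,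
        F₀ ((2 : ℂ)⁻¹ • fromBlocks (1 + v) (-(I • (1 - v))) (I • (1 - v)) (1 + v) : Matrix (Fin 2 ⊕ Fin 2) (Fin 2 ⊕ Fin 2) ℂ) = evalAt v hv Q) →
      ∃ G : ℂ → Matrix (Fin 2 ⊕ Fin 2) (Fin 2 ⊕ Fin 2) ℂ → ℂ,
      (∀ s : ℂ, ((2 : ℕ) : ℝ) / 2 < s.re → IsArchSiegelSection (fun z : ℂ => (conj z / ((‖z‖ : ℝ) : ℂ)) ^ (-(t w.1))) s (G s)) ∧
      (∀ s : ℂ, ((2 : ℕ) : ℝ) / 2 < s.re → ∀ (v : Matrix (Fin 2) (Fin 2) ℂ), vᴴ * v = 1 → ∀ hv : v.det ≠ 0,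
        G s ((2 : ℂ)⁻¹ • fromBlocks (1 + v) (-(I • (1 - v))) (I • (1 - v)) (1 + v) : Matrix (Fin 2 ⊕ Fin 2) (Fin 2 ⊕ Fin 2) ℂ) = evalAt v hv Q) ∧
      DifferentiableOn ℂ (fun s : ℂ => ∫ r : Fin 2 → Fin 2 → ℝ,
        G s ((fromBlocks 0 (B w) (C w) 0 : Matrix (Fin 2 ⊕ Fin 2) (Fin 2 ⊕ Fin 2) ℂ) * fromBlocks 1 (hermOfReal r) 0 1 * Pt S h w) * eb S h w (hermOfReal r))
        {s : ℂ | ((2 : ℕ) : ℝ) / 2 < s.re})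
    (hInd : ∀ (k' : ℤ), -2 ≤ k' → ∀ (Q : Carrier) (B' C' : Matrix (Fin 2) (Fin 2) ℂ),
      (fromBlocks 0 B' C' 0 : Matrix (Fin 2 ⊕ Fin 2) (Fin 2 ⊕ Fin 2) ℂ)ᴴ * Matrix.J (Fin 2) ℂ * (fromBlocks 0 B' C' 0 : Matrix (Fin 2 ⊕ Fin 2) (Fin 2 ⊕ Fin 2) ℂ) =
        Matrix.J (Fin 2) ℂ →
      ∀ (g' : Matrix (Fin 2 ⊕ Fin 2) (Fin 2 ⊕ Fin 2) ℂ), g'ᴴ * Matrix.J (Fin 2) ℂ * g' = Matrix.J (Fin 2) ℂ →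
      ∀ (hidx' : Matrix (Fin 2) (Fin 2) ℂ), hidx'ᴴ = hidx' → hidx'.det.re < 0 →
      ∀ (eb' : Matrix (Fin 2) (Fin 2) ℂ → ℂ), (∀ b, eb' b = cexp (-(2 * Real.pi * I) * (hidx' * b).trace)) →
      (∀ k₀ : Matrix (Fin 2 ⊕ Fin 2) (Fin 2 ⊕ Fin 2) ℂ, k₀ᴴ * Matrix.J (Fin 2) ℂ * k₀ = Matrix.J (Fin 2) ℂ →
        moeb k₀ (I • (1 : Matrix (Fin 2) (Fin 2) ℂ)) = I • 1 →
        ∃ P : MvPolynomial (((Fin 2 ⊕ Fin 2) × (Fin 2 ⊕ Fin 2)) ⊕ ((Fin 2 ⊕ Fin 2) × (Fin 2 ⊕ Fin 2))) ℂ,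
          ∀ (s : ℂ) (F : Matrix (Fin 2 ⊕ Fin 2) (Fin 2 ⊕ Fin 2) ℂ → ℂ), IsArchSiegelSection (fun z : ℂ => (conj z / ((‖z‖ : ℝ) : ℂ)) ^ k') s F →
            (∀ (v : Matrix (Fin 2) (Fin 2) ℂ), vᴴ * v = 1 → ∀ hv : v.det ≠ 0,
              F ((2 : ℂ)⁻¹ • fromBlocks (1 + v) (-(I • (1 - v))) (I • (1 - v)) (1 + v) : Matrix (Fin 2 ⊕ Fin 2) (Fin 2 ⊕ Fin 2) ℂ) = evalAt v hv Q) →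
            ∀ u : Matrix (Fin 2 ⊕ Fin 2) (Fin 2 ⊕ Fin 2) ℂ, uᴴ * Matrix.J (Fin 2) ℂ * u = Matrix.J (Fin 2) ℂ → moeb u (I • (1 : Matrix (Fin 2) (Fin 2) ℂ)) = I • 1 →
              F (u * k₀) = MvPolynomial.eval (Sum.elim (fun pq => u pq.1 pq.2) (fun pq => conj (u pq.1 pq.2))) P) →
      ∃ (Ew : ℂ → ℂ) (s₀ : ℝ), DifferentiableOn ℂ Ew {s : ℂ | 0 < s.re} ∧ ∀ s : ℂ, s₀ < s.re →
        ∀ F : Matrix (Fin 2 ⊕ Fin 2) (Fin 2 ⊕ Fin 2) ℂ → ℂ, IsArchSiegelSection (fun z : ℂ => (conj z / ((‖z‖ : ℝ) : ℂ)) ^ k') s F →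
          (∀ (v : Matrix (Fin 2) (Fin 2) ℂ), vᴴ * v = 1 → ∀ hv : v.det ≠ 0,
            F ((2 : ℂ)⁻¹ • fromBlocks (1 + v) (-(I • (1 - v))) (I • (1 - v)) (1 + v) : Matrix (Fin 2 ⊕ Fin 2) (Fin 2 ⊕ Fin 2) ℂ) = evalAt v hv Q) →
          ∫ r : Fin 2 → Fin 2 → ℝ, F ((fromBlocks 0 B' C' 0 : Matrix (Fin 2 ⊕ Fin 2) (Fin 2 ⊕ Fin 2) ℂ) * fromBlocks 1 (hermOfReal r) 0 1 * g') * eb' (hermOfReal r) =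
            Ew s)
    :
    ∀ (j : Fin m) (S : skewMatrices ((IsCMField.complexConj L : L ≃ₐ[Fp L] L) : L →+* L) ((gramR L e dV hdV dW hdW).map (algebraMap (Fp L) L)))
      (h : HA L e dV hdV dW hdW), (S : Matrix (Fin 2) (Fin 2) L).det ≠ 0 →
      ∃ F : ℂ → ℂ, DifferentiableOn ℂ F {s : ℂ | 0 < s.re} ∧ ∀ s : ℂ, ((2 : ℕ) : ℝ) / 2 < s.re → F s =
        archWhittakerIntegral L e dV hdV dW hdW (νinf (kindWFinset L e dV hdV dW hdW T₀ (S : Matrix (Fin 2) (Fin 2) L) h)) (S : Matrix (Fin 2) (Fin 2) L)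
          (FinfT j S h) (UnitaryGroup.archPart (Fp L) L (IsCMField.complexConj L) (2 + 2) (hermD L e dV hdV dW hdW) h) s := by
  -- the frames of record (★ p863767): closed forms, frame letters, anti-diagonal reading, conjugator, and `hex ⇐ heb, hW'`
  obtain ⟨T, Tinv, Fr, B, C, g, hTdef, hTinvdef, hFr, hT1, hT2, hTU, hTS, hTiv, hTN, hTV, hBC, hCu, hg, hhex⟩ :=
    exists_frames_hex_of_std' L e dV hdV dW hdW hdV0 hdW0 ht 𝒦' h𝒦' s₀ A hAlaw hfin hAc FinfT hread T₀ νinf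
  -- the anti-diagonal base point and the translated points lie in `U(J)` (★ `frame_archPart_weylDelta`, ★ `frame_mem`)
  have hx : ∀ w : {w : InfinitePlace L // w.IsComplex}, (fromBlocks 0 (B w) (C w) 0 : Matrix (Fin 2 ⊕ Fin 2) (Fin 2 ⊕ Fin 2) ℂ)ᴴ * Matrix.J (Fin 2) ℂ *
      (fromBlocks 0 (B w) (C w) 0 : Matrix (Fin 2 ⊕ Fin 2) (Fin 2 ⊕ Fin 2) ℂ) = Matrix.J (Fin 2) ℂ := fun w => by
    rw [← hBC w, ← frame_archPart_weylDelta L e dV hdV dW hdW T Tinv Fr hFr w]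
    exact frame_mem L e dV hdV dW hdW T Tinv Fr hFr hTU _ w
  have hPt : ∀ (S : skewMatrices ((IsCMField.complexConj L : L ≃ₐ[Fp L] L) : L →+* L) ((gramR L e dV hdV dW hdW).map (algebraMap (Fp L) L))) (h : HA L e dV hdV dW hdW)
      (w : {w : InfinitePlace L // w.IsComplex}),
      (Fr (UnitaryGroup.archPart (Fp L) L (IsCMField.complexConj L) (2 + 2) (hermD L e dV hdV dW hdW) h * g) w)ᴴ * Matrix.J (Fin 2) ℂ *
        Fr (UnitaryGroup.archPart (Fp L) L (IsCMField.complexConj L) (2 + 2) (hermD L e dV hdV dW hdW) h * g) w = Matrix.J (Fin 2) ℂ :=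
    fun _ h w => frame_mem L e dV hdV dW hdW T Tinv Fr hFr hTU _ w
  -- the framed index `h_w(S) = −2·(T_w)₂₂·σ_w(S)·(T_w⁻¹)₁₁`: hermitian, non-singular under the guard (★ p863806)
  have hherm : ∀ (S : skewMatrices ((IsCMField.complexConj L : L ≃ₐ[Fp L] L) : L →+* L) ((gramR L e dV hdV dW hdW).map (algebraMap (Fp L) L))) (h : HA L e dV hdV dW hdW)
      (w : {w : InfinitePlace L // w.IsComplex}),
      ((-2 : ℂ) • ((T w).toBlocks₂₂ * (S : Matrix (Fin 2) (Fin 2) L).map w.1.embedding * (Tinv w).toBlocks₁₁))ᴴ =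
        (-2 : ℂ) • ((T w).toBlocks₂₂ * (S : Matrix (Fin 2) (Fin 2) L).map w.1.embedding * (Tinv w).toBlocks₁₁) :=
    fun S _ w => framedIndex_conjTranspose_of_frame L e dV hdV dW hdW T Tinv hTdef hTinvdef hdV0 hdW0 (S : Matrix (Fin 2) (Fin 2) L) S.2 w
  have hdet : ∀ (S : skewMatrices ((IsCMField.complexConj L : L ≃ₐ[Fp L] L) : L →+* L) ((gramR L e dV hdV dW hdW).map (algebraMap (Fp L) L))),
      (S : Matrix (Fin 2) (Fin 2) L).det ≠ 0 → ∀ (h : HA L e dV hdV dW hdW) (w : {w : InfinitePlace L // w.IsComplex}),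
      ((-2 : ℂ) • ((T w).toBlocks₂₂ * (S : Matrix (Fin 2) (Fin 2) L).map w.1.embedding * (Tinv w).toBlocks₁₁)).det ≠ 0 :=
    fun S hS _ w => framedIndex_det_ne_zero_of_frame L e dV hdV dW hdW T Tinv hTdef hTinvdef hdV0 hdW0 (S : Matrix (Fin 2) (Fin 2) L) hS w
  -- `hex ⇐ heb, hW'`: `heb` by ★ `heb_of_skew` for `eb := e(−tr(h_w(↑S)·b))`, `hW'` by the sign dispatch
  exact hhex (fun S _ w b => cexp (-(2 * Real.pi * I) * (((-2 : ℂ) • ((T w).toBlocks₂₂ * (S : Matrix (Fin 2) (Fin 2) L).map w.1.embedding * (Tinv w).toBlocks₁₁)) * b).trace))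
    (fun S _ u => heb_of_skew L e dV hdV dW hdW T Tinv Fr hFr hT2 hTiv hTdef hTinvdef hdV0 hdW0 S u)
    (fun S hS h w Q => hW_of_signCases (fun S : skewMatrices ((IsCMField.complexConj L : L ≃ₐ[Fp L] L) : L →+* L) ((gramR L e dV hdV dW hdW).map (algebraMap (Fp L) L)) => (S : Matrix (Fin 2) (Fin 2) L).det ≠ 0)
      (fun w : {w : InfinitePlace L // w.IsComplex} => -(t w.1)) hk B C hx
      (fun (S : skewMatrices ((IsCMField.complexConj L : L ≃ₐ[Fp L] L) : L →+* L) ((gramR L e dV hdV dW hdW).map (algebraMap (Fp L) L))) (h : HA L e dV hdV dW hdW) (w : {w : InfinitePlace L // w.IsComplex}) =>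
        Fr (UnitaryGroup.archPart (Fp L) L (IsCMField.complexConj L) (2 + 2) (hermD L e dV hdV dW hdW) h * g) w) hPt
      (fun S _ w b => cexp (-(2 * Real.pi * I) * (((-2 : ℂ) • ((T w).toBlocks₂₂ * (S : Matrix (Fin 2) (Fin 2) L).map w.1.embedding * (Tinv w).toBlocks₁₁)) * b).trace))
      (fun S _ w => (-2 : ℂ) • ((T w).toBlocks₂₂ * (S : Matrix (Fin 2) (Fin 2) L).map w.1.embedding * (Tinv w).toBlocks₁₁))
      hherm hdet (fun _ _ _ _ => rfl) (((2 : ℕ) : ℝ) / 2) (by norm_num)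
      (hWhol B C _ _ _ hx hPt hherm (fun _ _ _ _ => rfl)) hInd S hS h w Q)

end Summit.HodgeConjecture.HodgeConjecture.Cruxes.HLiu418.K2LiuKindWArchHexOfDispatch

end
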